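import Literature.NumberTheory.DiophantineGeometry.GaudronRemondEllipticPairs
import Literature.NumberTheory.DiophantineGeometry.FaltingsHeightTheoryProofs
import Literature.NumberTheory.EllipticCurves.TateModuleTwistTransportProofs
import Literature.NumberTheory.EllipticCurves.ComplexMultiplicationHasCMProofs
import Literature.NumberTheory.EllipticCurves.IsogenyVariableChangeProofs
import Literature.NumberTheory.EllipticCurves.LocalKummerIsotropyTransport
import Literature.NumberTheory.EllipticCurves.RationalIsogenyDegreesProofs
import Literature.FieldTheory.RealClosed.FiniteExtension
import HarnessLib

/-!
# Masser–Wüstholz 1993 via quadratic twists: a "normaliser of Cartan" image over a number field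
# forces `ℓ ≤ B(E, E^{(d)})⁴` (Gaudron–Rémond), with `E ≁ E^{(d)}` and `h_F(E^{(d)}) = h_F(E)`

Topic `NumberTheory/EllipticCurves`; theorems only (no definitions, no named facts).  Part of the
road from the named facts `Literature.NumberTheory.DiophantineGeometry.GaudronRemond2023_torsionHom_ellipticPair`
(É. Gaudron, G. Rémond, *Nouveaux théorèmes d'isogénie*, Mém. SMF 176 (2023), Thm. 1.5 (1) +
Thm. 1.8 at `E × E'`) and `mazur_isogeny_irreducible` to
`Literature.NumberTheory.EllipticCurves.masserWustholz_surjective_modEll` (D. Masser,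
G. Wüstholz, Bull. LMS 25 (1993) 247–254, Theorem (b) over `ℚ`), replacing Lemma 3.2 of that
paper (isogeny estimates for `E × E`) by the twisting argument of J.-P. Serre, Invent. Math. 15
(1972) §4.2 c): if `ρ̄_{E,ℓ}(Γ_K)` lies in the normaliser `N` of a Cartan subgroup `C` but not in
`C`, the quadratic character `ε : Γ_K → N/C` cuts out `K(√d)`, and `E[ℓ] ≅ E[ℓ] ⊗ ε ≅ E^{(d)}[ℓ]`
as `Γ_K`-modules, while `E` and `E^{(d)}` are not isogenous over `K` when `End_{K̄} E = ℤ`.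

* `exists_eq_stabilizer_geomSqrt_of_index_eq_two` — **Kummer theory for index `2`**: an open
  subgroup of index `2` of `Γ_K` (`char K = 0`) is `Γ_{K(√d)} = Stab(√d)` for some `d ∈ Kˣ`
  (infinite Galois theory `InfiniteGalois.fixingSubgroup_fixedField` + the structure of quadratic
  extensions, `Literature.FieldTheory.RealClosed.exists_gen_of_finrank_eq_two`).
* `exists_addEquiv_quadraticTwist_sqrt` — the untwisting isomorphism `E^{(d)}(K̄) ≃+ E(K̄)` is
  algebraic and satisfies `f(σP) = σ f(P)` if `σ√d = √d`, `f(σP) = -σ f(P)` if `σ√d = -√d`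
  (Silverman *AEC* X.5 Cor. 5.4; the tree's `untwistEquiv_smul_of_eq(_neg)`).
* `not_isIsogenous_of_addEquiv_smul_eq_neg` — **`E ≁_K E'` if `End_{K̄} E = ℤ` and some
  algebraic `K̄`-isomorphism `f : E' ≅ E` is anti-equivariant for some `σ`** (`f ∘ φ ∈ End E = ℤ`
  would be `[n]` with `[n](σP) = -σ[n]P`, so `2n = 0`, `φ = 0`): in particular a non-CM curve is
  not isogenous over `K` to a non-trivial quadratic twist.
* `prime_le_of_addEquiv_sign` — **the bound**: `K` a number field, `E/K` non-CM, `ℓ` prime,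
  `U ≤ Γ_K` open of index `2`, and `M ∈ Aut(E[ℓ])` with `M(σP) = σ M(P)` for `σ ∈ U`,
  `M(σP) = -σ M(P)` for `σ ∉ U` (the element of `C` realising `ρ̄ ≅ ρ̄ ⊗ ε`,
  `Serre1972.exists_mem_forall_conj_eq_of_le_normalizer`); then
  `ℓ ≤ (241 (4e)⁸ 4⁵ [K:ℚ] max(1, log [K:ℚ], 2 h_F(E) + 3))⁴` — Gaudron–Rémond at the pair
  `(E, E^{(d)})`, `U = Γ_{K(√d)}`, with `h_F(E^{(d)}) = h_F(E)` (`stableFaltingsHeight_eq_of_j_eq`).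

## References

* [GaudronRemond2023] É. Gaudron, G. Rémond, Mém. SMF 176 (2023), Thm. 1.5 (1), Thm. 1.8.
* [Serre1972] J.-P. Serre, Invent. Math. 15 (1972), §4.2 c) (`ε_ℓ`, `K'_ℓ = K(√d)`), §2.2.
* [MasserWustholzBLMS1993] D. Masser, G. Wüstholz, Bull. LMS 25 (1993), §§3–4.
* [SilvermanAEC2009] J. H. Silverman, *AEC*, X.2 Prop. 2.4, X.5 Cor. 5.4, III.4, III.6.4.
-/

noncomputable section

open scoped Classical

universe u

namespace Literature.NumberTheory.EllipticCurves.MasserWustholz1993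

open _root_.WeierstrassCurve Field IntermediateField Literature.NumberTheory.DiophantineGeometry

/-! ### Kummer theory: open subgroups of index `2` of `Γ_K` -/

section Kummer

variable (K : Type u) [Field K] [CharZero K]

/-- **An open subgroup of index `2` of `Γ_K` is `Γ_{K(√d)}`** (`char K = 0`).  The closed
subgroup `U` is `Gal(K̄/F)` for its fixed field `F`, `[F : K] = (Γ_K : U) = 2`
(`InfiniteGalois.fixingSubgroup_fixedField`, `IntermediateField.finrank_eq_fixingSubgroup_index`);
a quadratic extension in characteristic `0` is `F = K(y)`, `y² = d ∈ K` not a square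
(`exists_gen_of_finrank_eq_two`); `y = ±√d`, so `Stab(√d)` fixes `F` and lies in `U`, and both
have index `2` (`index_stabilizer_geomSqrt`). [folklore] -/
theorem exists_eq_stabilizer_geomSqrt_of_index_eq_two (U : Subgroup (absoluteGaloisGroup K))
    (hU : IsOpen (U : Set (absoluteGaloisGroup K))) (hU2 : U.index = 2) :
    ∃ d : K, d ≠ 0 ∧ U = MulAction.stabilizer (absoluteGaloisGroup K) (geomSqrt d) := by
  haveI : IsGalois K (AlgebraicClosure K) := {}
  -- the fixed field `F` of `U`, of degree `2`
  let Uc : ClosedSubgroup (AlgebraicClosure K ≃ₐ[K] AlgebraicClosure K) :=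
    ⟨U, U.isClosed_of_isOpen hU⟩
  set F : IntermediateField K (AlgebraicClosure K) :=
    fixedField (Uc : Subgroup (AlgebraicClosure K ≃ₐ[K] AlgebraicClosure K)) with hF
  have hfix : F.fixingSubgroup = U := InfiniteGalois.fixingSubgroup_fixedField Uc
  haveI : FiniteDimensional K F := by rw [← InfiniteGalois.isOpen_iff_finite, hfix]; exact hU
  have hrank : Module.finrank K F = 2 := by
    rw [IntermediateField.finrank_eq_fixingSubgroup_index, hfix]; exact hU2
  have hFU : ∀ σ : absoluteGaloisGroup K, (∀ x ∈ F, σ • x = x) → σ ∈ U := by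
    intro σ hσ
    have hmem : absoluteGaloisGroup.toAlgEquiv K σ ∈ F.fixingSubgroup :=
      (IntermediateField.mem_fixingSubgroup_iff _ _).mpr hσ
    rwa [hfix] at hmem
  -- `F = K(y)`, `y² = d`
  obtain ⟨d, hdsq, y, hy, hspan⟩ :=
    Literature.FieldTheory.RealClosed.exists_gen_of_finrank_eq_two (F := K) (E := F) hrank
  have hd : d ≠ 0 := by
    rintro rfl
    exact hdsq IsSquare.zero
  -- `y = ± √d` in `K̄`
  have hy2 : ((y : F) : AlgebraicClosure K) ^ 2 = geomSqrt d ^ 2 := by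
    rw [geomSqrt_sq, sq, ← MulMemClass.coe_mul, hy]
    rfl
  have hyσ : ∀ σ : absoluteGaloisGroup K, σ • geomSqrt d = geomSqrt d →
      σ • ((y : F) : AlgebraicClosure K) = (y : AlgebraicClosure K) := by
    intro σ hσ
    rcases sq_eq_sq_iff_eq_or_eq_neg.mp hy2 with h | h
    · rw [h, hσ]
    · rw [h, smul_neg, hσ]
  -- `Stab(√d) ≤ U`
  have hle : MulAction.stabilizer (absoluteGaloisGroup K) (geomSqrt d) ≤ U := by
    intro σ hσ
    rw [MulAction.mem_stabilizer_iff] at hσ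
    refine hFU σ fun x hx ↦ ?_
    obtain ⟨u, v, huv⟩ := hspan ⟨x, hx⟩
    have hcoe : ∀ w : K, ((algebraMap K F w : F) : AlgebraicClosure K) =
        algebraMap K (AlgebraicClosure K) w := fun w ↦ rfl
    have hx' : x = algebraMap K (AlgebraicClosure K) u +
        algebraMap K (AlgebraicClosure K) v * (y : AlgebraicClosure K) := by
      have := congrArg (fun z : F ↦ (z : AlgebraicClosure K)) huv
      simpa only [AddMemClass.coe_add, MulMemClass.coe_mul, hcoe] using this
    rw [hx']
    change absoluteGaloisGroup.toAlgEquiv K σ _ = _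
    rw [map_add, map_mul, AlgEquiv.commutes, AlgEquiv.commutes]
    congr 1
    exact congrArg _ (hyσ σ hσ)
  -- both have index `2`
  refine ⟨d, hd, le_antisymm ?_ hle⟩
  have hidx : (MulAction.stabilizer (absoluteGaloisGroup K) (geomSqrt d)).index = 2 := by
    rcases index_stabilizer_geomSqrt (K := K) d with h1 | h2
    · exfalso
      have hdvd := Subgroup.index_dvd_of_le hle
      rw [h1, hU2] at hdvd
      omega
    · exact h2
  have hrel := Subgroup.relIndex_mul_index hle
  rw [hidx, hU2] at hrel
  have h1 : (MulAction.stabilizer (absoluteGaloisGroup K) (geomSqrt d)).relIndex U = 1 := by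
    omega
  exact Subgroup.relIndex_eq_one.mp h1

end Kummer

/-! ### The untwisting isomorphism `E^{(d)}(K̄) ≃+ E(K̄)`, with its sign and algebraicity -/

section Twist

variable {K : Type u} [Field K] [NeZero (2 : K)]

/-- **`E^{(d)}(K̄) ≃+ E(K̄)`, algebraic, equivariant up to the sign `σ√d/√d`** (Silverman *AEC*
X.5 Cor. 5.4, X.2 Prop. 2.4).  Same construction as the tree's
`exists_addEquiv_geomPoints_quadraticTwist(_signed)`: `W^{(d)} = W₀^{(d)}` for the model
`W₀ = W.toCharNeTwoNF • W` with `a₁ = a₃ = 0`, the untwisting `(x, y) ↦ (x/d, y/d√d)`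
(`untwistEquiv`, `untwistEquiv_smul_of_eq`, `untwistEquiv_smul_of_eq_neg`) and the change of
variables `W₀(K̄) ≃+ W(K̄)`; all three maps are algebraic (`isAlgebraicOn_id`,
`isAlgebraicOn_pointEquiv_trans_congrEquiv(_symm)`), hence so is the composite
(`IsAlgebraicOn.comp`). [cite: SilvermanAEC2009, X.5 Cor. 5.4 and X.2 Prop. 2.4] -/
theorem exists_addEquiv_quadraticTwist_sqrt (W : WeierstrassCurve K) {d : K} (hd : d ≠ 0) :
    ∃ f : (W.quadraticTwist d).geomPoints ≃+ W.geomPoints,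
      IsAlgebraicOn (W.quadraticTwist d) W f ∧
      ∀ σ : absoluteGaloisGroup K,
        (σ • geomSqrt d = geomSqrt d → ∀ P, f (σ • P) = σ • f P) ∧
        (σ • geomSqrt d = -geomSqrt d → ∀ P, f (σ • P) = -(σ • f P)) := by
  letI : Invertible (2 : K) := invertibleOfNonzero two_ne_zero
  set C : VariableChange K := W.toCharNeTwoNF with hC
  set V : WeierstrassCurve K := C • W with hV
  haveI : V.IsCharNeTwoNF := by rw [hV, hC]; infer_instance
  have hVW : W.quadraticTwist d = V.quadraticTwist d := by
    rw [hV, quadraticTwist_smul]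
    have h1 : (⟨C.u, d * C.r, 0, 0⟩ : VariableChange K) = 1 := by
      simp only [hC, toCharNeTwoNF, mul_zero]
      rfl
    rw [h1, one_smul]
  let e₁ : (W.quadraticTwist d).geomPoints ≃+ (V.quadraticTwist d).geomPoints :=
    Affine.Point.congrEquiv
      (congrArg (fun Z : WeierstrassCurve K ↦ Z.baseChange (AlgebraicClosure K)) hVW)
  let e₂ : (V.quadraticTwist d).geomPoints ≃+ V.geomPoints := untwistEquiv V hd
  let e₃ : V.geomPoints ≃+ W.geomPoints :=
    (VariableChange.pointEquivBaseChange W C (AlgebraicClosure K)).symm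
  -- algebraicity of the three maps
  have halg₁ : ∀ {X Y : WeierstrassCurve K} (h : X = Y),
      IsAlgebraicOn X Y (Affine.Point.congrEquiv
        (congrArg (fun Z : WeierstrassCurve K ↦ Z.baseChange (AlgebraicClosure K)) h)) := by
    intro X Y h
    subst h
    exact isAlgebraicOn_id X
  have halg₂ : IsAlgebraicOn (V.quadraticTwist d) V e₂ :=
    isAlgebraicOn_pointEquiv_trans_congrEquiv (untwist hd) (untwist_smul_eq V hd)
  have halg₃ : IsAlgebraicOn V W e₃ :=
    isAlgebraicOn_pointEquiv_trans_congrEquiv_symm (C.map (algebraMap K (AlgebraicClosure K)))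
      (VariableChange.baseChange_smul_eq W C (AlgebraicClosure K)).symm
  have halg : IsAlgebraicOn (W.quadraticTwist d) W ((e₁.trans e₂).trans e₃) := by
    have h12 : IsAlgebraicOn (W.quadraticTwist d) V (e₂.toAddMonoidHom.comp e₁.toAddMonoidHom) :=
      IsAlgebraicOn.comp (f := e₂.toAddMonoidHom) (g := e₁.toAddMonoidHom) halg₂ (halg₁ hVW)
    exact IsAlgebraicOn.comp (f := e₃.toAddMonoidHom)
      (g := e₂.toAddMonoidHom.comp e₁.toAddMonoidHom) halg₃ h12
  refine ⟨(e₁.trans e₂).trans e₃, halg, fun σ ↦ ?_⟩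
  have h₁ : ∀ P, e₁ (σ • P) = σ • e₁ P := fun P ↦
    congrEquiv_smul_of_eq hVW (absoluteGaloisGroup.toAlgEquiv K σ) P
  have h₃ : ∀ Q : V.geomPoints, e₃ (σ • Q) = σ • e₃ Q := by
    intro Q
    apply (VariableChange.pointEquivBaseChange W C (AlgebraicClosure K)).injective
    change VariableChange.pointEquivBaseChange W C (AlgebraicClosure K)
        ((VariableChange.pointEquivBaseChange W C (AlgebraicClosure K)).symm
          (Affine.Point.map ((absoluteGaloisGroup.toAlgEquiv K σ : _) :
            AlgebraicClosure K →ₐ[K] AlgebraicClosure K) Q)) =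
      VariableChange.pointEquivBaseChange W C (AlgebraicClosure K)
        (Affine.Point.map ((absoluteGaloisGroup.toAlgEquiv K σ : _) :
            AlgebraicClosure K →ₐ[K] AlgebraicClosure K)
          ((VariableChange.pointEquivBaseChange W C (AlgebraicClosure K)).symm Q))
    rw [AddEquiv.apply_symm_apply, VariableChange.pointEquivBaseChange_map_algEquiv,
      AddEquiv.apply_symm_apply]
  refine ⟨fun hσ P ↦ ?_, fun hσ P ↦ ?_⟩
  · simp only [AddEquiv.trans_apply]
    rw [h₁, untwistEquiv_smul_of_eq V hd σ hσ (e₁ P), h₃]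
  · simp only [AddEquiv.trans_apply]
    rw [h₁, untwistEquiv_smul_of_eq_neg V hd σ hσ (e₁ P), map_neg, h₃]

end Twist

/-! ### Non-isogeny of a non-CM curve with its non-trivial twists -/

section NonIsogeny

variable {K : Type u} [Field K] [CharZero K] {W W' : WeierstrassCurve K} [W.IsElliptic]

/-- **A non-CM curve is not `K`-isogenous to an anti-equivariantly `K̄`-isomorphic curve.**  Let
`End_{K̄}(E) = ℤ` and let `f : E'(K̄) ≃+ E(K̄)` be algebraic with `f(σP) = -σ f(P)` for all `P`,
for some `σ ∈ Γ_K` (e.g. the untwisting `E^{(d)} ≅ E` and `σ√d = -√d`).  Then there is no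
isogeny `φ : E → E'` over `K`: `f ∘ φ ∈ End_{K̄}(E)` is some `[n]`, and
`[n](σP) = f(φ(σP)) = f(σ φ P) = -σ [n] P = -[n](σP)` gives `[2n] = 0` on `E(K̄)`, so `n = 0`
(`E(K̄)` is infinite, `E[2n]` is finite), `φ = 0`, against the finiteness of `ker φ`.  (The
classical statement: `E` and `E^{(d)}` isogenous over `K` with `d ∉ K²` forces CM.)
[cite: SilvermanAEC2009, III.4, III.6.4(b), X.5 Cor. 5.4] -/
theorem not_isIsogenous_of_addEquiv_smul_eq_neg (hW : ¬ W.HasCM)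
    (f : W'.geomPoints ≃+ W.geomPoints) (hf : IsAlgebraicOn W' W f)
    {σ : absoluteGaloisGroup K} (hσ : ∀ P, f (σ • P) = -(σ • f P)) :
    ¬ IsIsogenous W W' := by
  rintro ⟨φ⟩
  -- `f ∘ φ ∈ End_{K̄}(E) = ℤ`
  have halg : IsAlgebraicOn W W (f.toAddMonoidHom.comp φ.toAddMonoidHom) :=
    IsAlgebraicOn.comp (f := f.toAddMonoidHom) (g := φ.toAddMonoidHom) hf φ.isAlgebraic
  have hmem : ((f.toAddMonoidHom.comp φ.toAddMonoidHom : W.geomPoints →+ W.geomPoints) :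
      AddMonoid.End W.geomPoints) ∈ W.geomEndRing :=
    Subring.subset_closure halg
  obtain ⟨n, hn⟩ : ∃ n : ℤ, ((f.toAddMonoidHom.comp φ.toAddMonoidHom :
      W.geomPoints →+ W.geomPoints) : AddMonoid.End W.geomPoints) =
        ((n : ℤ) : AddMonoid.End W.geomPoints) := by
    by_contra h
    push Not at h
    exact hW ⟨_, hmem, h⟩
  have hψ : ∀ P, f (φ P) = n • P := fun P ↦ by
    have := DFunLike.congr_fun hn P
    change f (φ P) = ((n : ℤ) : AddMonoid.End W.geomPoints) P at this
    rwa [AddMonoid.End.intCast_apply] at this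
  -- `[2n] = 0` on `E(K̄)`
  have h2n : ∀ Q : W.geomPoints, (2 * n) • Q = 0 := by
    intro Q
    obtain ⟨P, rfl⟩ : ∃ P, σ • P = Q := ⟨σ⁻¹ • Q, smul_inv_smul σ Q⟩
    have e1 : f (φ (σ • P)) = n • (σ • P) := hψ _
    have hcomm : σ • (n • P) = n • (σ • P) :=
      map_zsmul (DistribSMul.toAddMonoidHom W.geomPoints σ) n P
    have e2 : f (φ (σ • P)) = -(n • (σ • P)) := by
      rw [Isogeny.map_smul, hσ, hψ, hcomm]
    rw [mul_zsmul, two_zsmul]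
    have : n • (σ • P) = -(n • (σ • P)) := e1.symm.trans e2
    exact eq_neg_iff_add_eq_zero.mp this
  -- hence `n = 0`
  have hn0 : n = 0 := by
    by_contra hn0
    have h2n0 : (2 * n : ℤ) ≠ 0 := mul_ne_zero two_ne_zero hn0
    have htop : geomTorsion W (2 * n) = ⊤ := by
      ext Q
      simp only [AddSubgroup.mem_top, iff_true]
      exact (Submodule.mem_torsionBy_iff _ _).mpr (h2n Q)
    have hc := natCard_geomTorsion_int_eq_sq W h2n0
    rw [htop, AddSubgroup.card_top, Nat.card_eq_zero_of_infinite] at hc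
    have : (2 * n).natAbs = 0 := by
      have h := hc.symm
      rwa [pow_eq_zero_iff two_ne_zero] at h
    exact h2n0 (Int.natAbs_eq_zero.mp this)
  -- so `φ = 0` and `ker φ = E(K̄)` is infinite
  have hφ0 : ∀ P, φ P = 0 := fun P ↦ f.injective (by rw [hψ, hn0, zero_smul, map_zero])
  have hker : (φ.toAddMonoidHom.ker : Set W.geomPoints) = Set.univ := by
    ext P
    simp [hφ0 P]
  exact Set.infinite_univ (by rw [← hker]; exact φ.finite_ker)

end NonIsogeny

/-! ### The Gaudron–Rémond bound for an image in the normaliser of a Cartan subgroup -/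

section Bound

variable (K : Type) [Field K] [NumberField K] (V : WeierstrassCurve K) [V.IsElliptic]

/-- **The twist bound.**  Let `K` be a number field, `E = V` an elliptic curve over `K` without
CM over `K̄`, `ℓ` a prime, `U ≤ Γ_K` an open subgroup of index `2`, and `M ∈ Aut(E[ℓ])` with
`M(σP) = σ M(P)` for `σ ∈ U` and `M(σP) = -σ M(P)` for `σ ∉ U`.  Then
`ℓ ≤ (241 (4e)⁸ 4⁵ [K:ℚ] max(1, log [K:ℚ], 2 h_F(E) + 3))⁴`.  Proof: `U = Γ_{K(√d)}`
(`exists_eq_stabilizer_geomSqrt_of_index_eq_two`); with the untwisting `t : E^{(d)}(K̄) ≅ E(K̄)`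
(sign `σ√d/√d`, the same as that of `M`) the map `t⁻¹ ∘ M : E[ℓ] ≃+ E^{(d)}[ℓ]` is
`Γ_K`-equivariant; `E ≁_K E^{(d)}` (`not_isIsogenous_of_addEquiv_smul_eq_neg`, using
`σ₀ ∉ U`); so the named fact `GaudronRemond2023_torsionHom_ellipticPair` gives
`ℓ ≤ B(E, E^{(d)})⁴`, and `h_F(E^{(d)}) = h_F(E)` as `j(E^{(d)}) = j(E)`
(`stableFaltingsHeight_eq_of_j_eq`).  This is Serre's twisting argument (1972, §4.2 c)) made
effective by Gaudron–Rémond, in the role of Lemma 3.2 of Masser–Wüstholz 1993.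
[cite: GaudronRemond2023, Thm. 1.5 (1) and Thm. 1.8] [cite: Serre1972, §4.2 c)] -/
theorem prime_le_of_addEquiv_sign (hGR : GaudronRemond2023_torsionHom_ellipticPair)
    (hV : ¬ V.HasCM) {ℓ : ℕ} (hℓ : ℓ.Prime) (U : Subgroup (absoluteGaloisGroup K))
    (hUo : IsOpen (U : Set (absoluteGaloisGroup K))) (hU2 : U.index = 2)
    (M : V.geomTorsion ℓ ≃+ V.geomTorsion ℓ)
    (hM₁ : ∀ σ ∈ U, ∀ P, M (σ • P) = σ • M P)
    (hM₂ : ∀ σ ∉ U, ∀ P, M (σ • P) = -(σ • M P)) :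
    (ℓ : ℝ) ≤ (241 * (4 * Real.exp 1) ^ 8 * 4 ^ 5 * Module.finrank ℚ K *
      max 1 (max (Real.log (Module.finrank ℚ K)) (2 * V.stableFaltingsHeight + 3))) ^ 4 := by
  haveI : NeZero (2 : K) := ⟨two_ne_zero⟩
  -- `U = Γ_{K(√d)}`
  obtain ⟨d, hd, hUd⟩ := exists_eq_stabilizer_geomSqrt_of_index_eq_two K U hUo hU2
  haveI : (V.quadraticTwist d).IsElliptic := isElliptic_quadraticTwist V hd
  obtain ⟨t, htalg, ht⟩ := exists_addEquiv_quadraticTwist_sqrt V hd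
  have hmemU : ∀ σ : absoluteGaloisGroup K, σ ∈ U ↔ σ • geomSqrt d = geomSqrt d := by
    intro σ; rw [hUd]; exact MulAction.mem_stabilizer_iff
  have hsgn : ∀ σ : absoluteGaloisGroup K, σ ∉ U → σ • geomSqrt d = -geomSqrt d := by
    intro σ hσ
    rcases map_geomSqrt (absoluteGaloisGroup.toAlgEquiv K σ) d with h | h
    · exact absurd ((hmemU σ).mpr h) hσ
    · exact h
  -- some `σ₀ ∉ U`
  obtain ⟨σ₀, hσ₀⟩ : ∃ σ₀ : absoluteGaloisGroup K, σ₀ ∉ U := by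
    by_contra! h
    have htop : U = ⊤ := eq_top_iff.mpr fun σ _ ↦ h σ
    rw [htop, Subgroup.index_top] at hU2
    exact absurd hU2 (by norm_num)
  -- `E ≁ E^{(d)}`
  have hniso : ¬ IsIsogenous V (V.quadraticTwist d) :=
    not_isIsogenous_of_addEquiv_smul_eq_neg hV t htalg ((ht σ₀).2 (hsgn σ₀ hσ₀))
  -- `t⁻¹` on points, with its sign
  have ht₁ : ∀ σ ∈ U, ∀ x : V.geomPoints, t.symm (σ • x) = σ • t.symm x := by
    intro σ hσ x
    apply t.injective
    rw [AddEquiv.apply_symm_apply, (ht σ).1 ((hmemU σ).mp hσ), AddEquiv.apply_symm_apply]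
  have ht₂ : ∀ σ ∉ U, ∀ x : V.geomPoints, t.symm (σ • x) = -(σ • t.symm x) := by
    intro σ hσ x
    apply t.injective
    rw [AddEquiv.apply_symm_apply, map_neg, (ht σ).2 (hsgn σ hσ), neg_neg,
      AddEquiv.apply_symm_apply]
  -- the equivariant isomorphism `E[ℓ] ≃+ E^{(d)}[ℓ]`
  let e : V.geomTorsion ℓ ≃+ (V.quadraticTwist d).geomTorsion ℓ :=
    M.trans (torsionByCongr t.symm ℓ)
  have he : ∀ (σ : absoluteGaloisGroup K) (P : V.geomTorsion ℓ), e (σ • P) = σ • e P := by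
    intro σ P
    apply Subtype.ext
    change t.symm ((M (σ • P) : V.geomTorsion ℓ) : V.geomPoints) =
      σ • t.symm ((M P : V.geomTorsion ℓ) : V.geomPoints)
    by_cases hσ : σ ∈ U
    · rw [hM₁ σ hσ P]
      exact ht₁ σ hσ _
    · rw [hM₂ σ hσ P, NegMemClass.coe_neg, map_neg]
      change -t.symm (σ • ((M P : V.geomTorsion ℓ) : V.geomPoints)) = _
      rw [ht₂ σ hσ, neg_neg]
  -- a non-zero `ℓ`-torsion point
  have hE : ∃ P : V.geomTorsion ℓ, P ≠ 0 := by
    have hcard : Nat.card (V.geomTorsion ℓ) = ℓ ^ 2 :=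
      natCard_geomTorsion_eq_sq V (n := ℓ) (by exact_mod_cast hℓ.ne_zero)
    have h1 : 1 < Nat.card (V.geomTorsion ℓ) := by
      rw [hcard]
      exact Nat.one_lt_pow two_ne_zero hℓ.one_lt
    haveI : Finite (V.geomTorsion ℓ) := Nat.finite_of_card_ne_zero (by omega)
    obtain ⟨P, Q, hPQ⟩ := Finite.one_lt_card_iff_nontrivial.mp h1
    by_cases hP : P = 0
    · exact ⟨Q, fun hQ ↦ hPQ (hP.trans hQ.symm)⟩
    · exact ⟨P, hP⟩
  have hbound := hGR.prime_le_of_equivariant_addEquiv hniso hℓ hE e he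
  have hh : (V.quadraticTwist d).stableFaltingsHeight = V.stableFaltingsHeight :=
    stableFaltingsHeight_eq_of_j_eq _ _ (j_quadraticTwist V hd)
  unfold grPairBound at hbound
  rw [hh, ← two_mul] at hbound
  exact hbound

end Bound

end Literature.NumberTheory.EllipticCurves.MasserWustholz1993

end
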